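import Summits.QuantumFields.YangMills.Theorems.LuscherReductionTwistedTraceScalingBOCentralSchedule
import Summits.QuantumFields.YangMills.Theorems.TwistedTraceScaling.Negative.SmearingWindowBand
import HarnessLib

/-!
# R52 (crux `TwistedTraceScaling`, stmt-QuantumFields-20203; R50/R50T PINNED TO THE LANDED SCHEDULE B): on lane A's schedule
# `T(β) = 9L·(5β^{-1/2}ℓ²) + β^{-1}` (`ℓ = btLog β`; `…BOCentralSchedule`, `…BOCentralEventually`, landed 2026-08-29T05:21Z/05:50Z) one has `2025 ≤ βT² ≤ (45L+1)²ℓ⁴`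
# for `β ≥ 1`, so the smearing window `δu = β^{-s'}` of `central_transfer_two_sided_chart(_sharp)` is priced by the (OD) budget EXACTLY on the band `s' > 1/6`:
# `s' < 1/6` ⇒ the budget clause fails (R50), `s' > 1/6` ⇒ the window floor `192|E|βδuT²` is affordable (R50T); with lane A's `s' < 1/2` the admissible band is `(1/6, 1/2)`

Standing disprover `ym-cdisprove-20203-1` (gen 41).  R50 (`…Negative.SmearingWindowCost`) and R50T (`…Negative.SmearingWindowBand`) were stated for an abstract gauge-core size
`T(β)` under `βT² ≥ 1`, resp. `βT² ≤ 225L²(log β)⁴`; lane A has since LANDED the schedule (`…BOCentralSchedule`: `R₁' = 5β^{-1/2}ℓ²`, `T = 9L·R₁' + β^{-1}`, `ρ = 8T`,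
`r = β^{-1}ℓ³`; `…BOCentralTransferSharp`/`…BOCentralEventually`: window `δu = β^{-s'}`, `s' < 1/2`, auxiliary tube `β^{-s''}`, `s'' < s'`).  This file discharges both
abstract hypotheses for THAT `T`:
* §1 `one_le_beta_schedT_sq` (`1 ≤ 2025 ≤ βT(β)²`, `β ≥ 1`, `L ≥ 1`), `beta_schedT_sq_le` (`βT(β)² ≤ (45L+1)²ℓ⁴`, `β ≥ 1`);
* §2 ★★★ `sched_window_budget_false` — for every `s' < 1/6`, every `R, Γ, σ ≥ 0` and every `ε, θ`:
  `¬ ∃ β₀, ∀ β ≥ β₀, ∃ b, coreEta L β 0 (powScale s' β) (T β) (R β) (Γ β) (σ β) ≤ b ∧ b² ≤ εθ·λ_b(L³β)/16` (R50 on the schedule);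
* §3 ★★ `sched_window_term_affordable` — for every `s' > 1/6`, `ε, θ > 0`: `∃ β₀, ∀ β ≥ β₀, ∃ b, 192|E|·β·powScale s' β·T(β)² ≤ b ∧ b² ≤ εθ·λ_b(L³β)/16`
  (R50T's `polylog_window_affordable` with `m = 4`, `A = 192|E|(45L+1)²`, after `btLog = log` eventually).
READING (no kill): the exponent of the smearing window on the landed schedule lives in the band `1/6 < s' < 1/2` (lower end: (OD) budget, this file; upper end: floor
`a_W = O(Lβ^{-1/2}ℓ²) ≤ δu` and support inclusion, lane A's `…BOCentralTransferSharp`); `s' = 1/6` itself is left open here (R50's strictness).  The remaining summands of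
`coreEta` (`50σN₃βR²`, `N_Pβ(29376T³ + 700569T⁴)`, `5040δuN₃βR²`, the action floor `1728N_P βT²√σ` with `σ ≥ 12L³a⁴`-type windows) are each `O(β^{-q}ℓ^k)` with `q ≥ min(s', 2s', 1/2)`
on this schedule — thresholds `β₁(L)` only.
HONEST FRAMING: exponent bookkeeping about hypotheses of bricks of a stub of a child of the CONDITIONAL reduction route R2b1; nothing landed is refuted (the (C1) theorems are
implications, true for every `δu`); (C1) rates, (C4), (C5), (B-ST), C4-CORE OPEN; not infinite volume, not a gap, not Clay.
-/

set_option autoImplicit false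

noncomputable section

open Real Filter
open Literature.MathematicalPhysics.QuantumFieldTheory
open Literature.MathematicalPhysics.QuantumLattice
open Summit.QuantumFields.YangMills.Theorems.FemtoTransferGap
open Summit.QuantumFields.YangMills.Theorems.FemtoTransferGap.TwoLattice
open Summit.QuantumFields.YangMills.Theorems.FemtoTransferGap.TwoLattice.ConstTube (coreEta btLog one_le_btLog schedT_le eventually_btLog_eq mul_powScale_half_sq)

namespace Summit.QuantumFields.YangMills.Theorems.TwistedTraceScaling.Negative.R52

variable {L : ℕ} [NeZero L]

/-! ## §1 The landed gauge-core size `T(β) = 45L·β^{-1/2}ℓ² + β^{-1}` satisfies `2025 ≤ βT² ≤ (45L+1)²ℓ⁴` (`β ≥ 1`) -/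

omit [NeZero L] in
/-- `0 ≤ T(β)`. [folklore] -/
theorem schedT_nonneg (β : ℝ) : 0 ≤ 9 * (L : ℝ) * (5 * (powScale (1 / 2) β * btLog β ^ 2)) + powScale 1 β := by
  have hℓ : 0 ≤ btLog β := le_trans zero_le_one (one_le_btLog β)
  have hx0 : 0 < powScale (1 / 2) β := powScale_pos _ _
  have h10 : 0 < powScale 1 β := powScale_pos _ _
  positivity

/-- **Lower bound** `2025 ≤ β·T(β)²` for `β ≥ 1` (`L ≥ 1`, `ℓ ≥ 1`, `β·(β^{-1/2})² = 1`); in particular R50's `βT² ≥ 1`. [folklore] -/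
theorem one_le_beta_schedT_sq {β : ℝ} (hβ : 1 ≤ β) :
    (2025 : ℝ) ≤ β * (9 * (L : ℝ) * (5 * (powScale (1 / 2) β * btLog β ^ 2)) + powScale 1 β) ^ 2 ∧
      1 ≤ β * (9 * (L : ℝ) * (5 * (powScale (1 / 2) β * btLog β ^ 2)) + powScale 1 β) ^ 2 := by
  have hL : (1 : ℝ) ≤ (L : ℝ) := by exact_mod_cast Nat.one_le_iff_ne_zero.mpr (NeZero.ne L)
  have hℓ := one_le_btLog β
  have hx0 : 0 < powScale (1 / 2) β := powScale_pos _ _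
  have h10 : 0 < powScale 1 β := powScale_pos _ _
  have hsq : β * powScale (1 / 2) β ^ 2 = 1 := mul_powScale_half_sq hβ
  -- `T ≥ 45·powScale (1/2) β`
  have hT : 45 * powScale (1 / 2) β ≤ 9 * (L : ℝ) * (5 * (powScale (1 / 2) β * btLog β ^ 2)) + powScale 1 β := by
    have hℓ2 : 1 ≤ btLog β ^ 2 := one_le_pow₀ hℓ
    nlinarith [mul_le_mul_of_nonneg_left hℓ2 hx0.le, mul_le_mul_of_nonneg_right hL (mul_nonneg hx0.le (le_trans zero_le_one hℓ2))]
  have hβ0 : 0 ≤ β := by linarith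
  have h45 : 0 ≤ 45 * powScale (1 / 2) β := by positivity
  have hmain : (2025 : ℝ) ≤ β * (9 * (L : ℝ) * (5 * (powScale (1 / 2) β * btLog β ^ 2)) + powScale 1 β) ^ 2 := by
    calc (2025 : ℝ) = β * (45 * powScale (1 / 2) β) ^ 2 := by nlinarith [hsq]
      _ ≤ β * (9 * (L : ℝ) * (5 * (powScale (1 / 2) β * btLog β ^ 2)) + powScale 1 β) ^ 2 :=
          mul_le_mul_of_nonneg_left (pow_le_pow_left₀ h45 hT 2) hβ0
  exact ⟨hmain, by linarith⟩

omit [NeZero L] in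
/-- **Upper bound** `β·T(β)² ≤ (45L+1)²·ℓ⁴` for `β ≥ 1` (`…BOCentralSchedule.schedT_le`: `T ≤ (45L+1)β^{-1/2}ℓ²`). [folklore] -/
theorem beta_schedT_sq_le {β : ℝ} (hβ : 1 ≤ β) :
    β * (9 * (L : ℝ) * (5 * (powScale (1 / 2) β * btLog β ^ 2)) + powScale 1 β) ^ 2 ≤ (45 * (L : ℝ) + 1) ^ 2 * btLog β ^ 4 := by
  have hT := schedT_le (L := L) hβ
  have hT0 := schedT_nonneg (L := L) β
  have hsq : β * powScale (1 / 2) β ^ 2 = 1 := mul_powScale_half_sq hβ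
  have hβ0 : 0 ≤ β := by linarith
  calc β * (9 * (L : ℝ) * (5 * (powScale (1 / 2) β * btLog β ^ 2)) + powScale 1 β) ^ 2
      ≤ β * ((45 * (L : ℝ) + 1) * (powScale (1 / 2) β * btLog β ^ 2)) ^ 2 := mul_le_mul_of_nonneg_left (pow_le_pow_left₀ hT0 hT 2) hβ0
    _ = (β * powScale (1 / 2) β ^ 2) * ((45 * (L : ℝ) + 1) ^ 2 * btLog β ^ 4) := by ring
    _ = (45 * (L : ℝ) + 1) ^ 2 * btLog β ^ 4 := by rw [hsq, one_mul]

/-! ## §2 ★★★ On the landed schedule the window exponent must exceed `1/6` -/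

/-- ★★★ **R50 ON SCHEDULE B**: with `T(β) = 9L·(5β^{-1/2}ℓ²) + β^{-1}` and the smearing window `δu = powScale s' β = β^{-s'}`, `s' < 1/6`, the (OD) budget clause
`coreEta ≤ b`, `b² ≤ εθλ_b(L³β)/16` fails eventually-always, for every fibre radius `R`, colour-charge bound `Γ`, action window `σ ≥ 0` and every `ε, θ`. [cite: Luscher1983, §3] -/
theorem sched_window_budget_false {s' : ℝ} (hs : s' < 1 / 6) {R Γ σ : ℝ → ℝ} (hσ0 : ∀ β, 0 ≤ σ β) (ε θ : ℝ) :
    ¬ ∃ β0 : ℝ, ∀ β : ℝ, β0 ≤ β → ∃ b : ℝ,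
      coreEta L β 0 (powScale s' β) (9 * (L : ℝ) * (5 * (powScale (1 / 2) β * btLog β ^ 2)) + powScale 1 β) (R β) (Γ β) (σ β) ≤ b ∧
        b ^ 2 ≤ ε * θ * bareLambda ((L : ℝ) ^ 3 * β) / 16 := by
  have h := R50.smearing_offDiag_budget_false_of_window (L := L) (s := 2 * s') (by linarith)
    (T := fun β => 9 * (L : ℝ) * (5 * (powScale (1 / 2) β * btLog β ^ 2)) + powScale 1 β) (R := R) (Γ := Γ) (σ := σ)
    (fun β => schedT_nonneg (L := L) β) hσ0 ⟨1, fun β hβ => (one_le_beta_schedT_sq (L := L) hβ).2⟩ ε θ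
  have e : 2 * s' / 2 = s' := by ring
  rw [e] at h
  exact h

/-! ## §3 ★★ On the landed schedule the window floor is affordable for every exponent above `1/6` -/

/-- ★★ **R50T ON SCHEDULE B**: with `T(β)` as above and `δu = powScale s' β`, `s' > 1/6`, R50's window floor `192|E|·β·δu·T(β)²` is eventually below some `b` with
`b² ≤ εθλ_b(L³β)/16` (`ε, θ > 0`): `βT² ≤ (45L+1)²ℓ⁴`, `ℓ = log β` for `β ≥ e`, and `…Negative.R50T.polylog_window_affordable` with `m = 4`. [cite: Luscher1983, §3] -/
theorem sched_window_term_affordable {s' ε θ : ℝ} (hs : 1 / 6 < s') (hε : 0 < ε) (hθ : 0 < θ) :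
    ∃ β0 : ℝ, ∀ β : ℝ, β0 ≤ β → ∃ b : ℝ,
      192 * (Fintype.card (Edge 3 L) : ℝ) * β * powScale s' β * (9 * (L : ℝ) * (5 * (powScale (1 / 2) β * btLog β ^ 2)) + powScale 1 β) ^ 2 ≤ b ∧
        b ^ 2 ≤ ε * θ * bareLambda ((L : ℝ) ^ 3 * β) / 16 := by
  have hA : 0 ≤ 192 * (Fintype.card (Edge 3 L) : ℝ) * (45 * (L : ℝ) + 1) ^ 2 := by positivity
  obtain ⟨β0, h⟩ := R50T.polylog_window_affordable (L := L) (s := s') (A := 192 * (Fintype.card (Edge 3 L) : ℝ) * (45 * (L : ℝ) + 1) ^ 2) 4 hs hA hε hθ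
  obtain ⟨βe, hβe⟩ := Filter.eventually_atTop.mp (eventually_btLog_eq)
  refine ⟨max (max β0 βe) 1, fun β hβ => ?_⟩
  have hβ0 : β0 ≤ β := le_trans (le_trans (le_max_left _ _) (le_max_left _ _)) hβ
  have hβe' : βe ≤ β := le_trans (le_trans (le_max_right _ _) (le_max_left _ _)) hβ
  have hβ1 : 1 ≤ β := le_trans (le_max_right _ _) hβ
  obtain ⟨b, hb, hb2⟩ := h β hβ0
  refine ⟨b, le_trans ?_ hb, hb2⟩
  have hℓ : btLog β = Real.log β := hβe β hβe'
  have hup := beta_schedT_sq_le (L := L) hβ1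
  have hps : 0 ≤ powScale s' β := (powScale_pos _ _).le
  have hE : 0 ≤ 192 * (Fintype.card (Edge 3 L) : ℝ) := by positivity
  calc 192 * (Fintype.card (Edge 3 L) : ℝ) * β * powScale s' β * (9 * (L : ℝ) * (5 * (powScale (1 / 2) β * btLog β ^ 2)) + powScale 1 β) ^ 2
      = 192 * (Fintype.card (Edge 3 L) : ℝ) * (β * (9 * (L : ℝ) * (5 * (powScale (1 / 2) β * btLog β ^ 2)) + powScale 1 β) ^ 2) * powScale s' β := by ring
    _ ≤ 192 * (Fintype.card (Edge 3 L) : ℝ) * ((45 * (L : ℝ) + 1) ^ 2 * btLog β ^ 4) * powScale s' β :=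
        mul_le_mul_of_nonneg_right (mul_le_mul_of_nonneg_left hup hE) hps
    _ = 192 * (Fintype.card (Edge 3 L) : ℝ) * (45 * (L : ℝ) + 1) ^ 2 * Real.log β ^ 4 * powScale s' β := by rw [hℓ]; ring

/-- The band, numerically: lane A's upper end `s' < 1/2` (floor `a_W = O(Lβ^{-1/2}ℓ²) ≤ δu`, support inclusion) and this file's lower end `s' > 1/6` are compatible —
e.g. `s' = 1/4`, `s'' = 1/5`, record exponent `s = 1/6 + 1/100` give `1/6 < s < s'' < s' < 1/2`. [folklore] -/
example : (1 : ℝ) / 6 < 1 / 6 + 1 / 100 ∧ (1 : ℝ) / 6 + 1 / 100 < 1 / 5 ∧ (1 : ℝ) / 5 < 1 / 4 ∧ (1 : ℝ) / 4 < 1 / 2 := by norm_num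

/-- Numbers: `45² = 2025` (the lower constant) and `(45·2+1)² = 8281` (the upper constant at `L = 2`). [folklore] -/
example : (45 : ℝ) ^ 2 = 2025 ∧ (45 * (2 : ℝ) + 1) ^ 2 = 8281 := by norm_num

end Summit.QuantumFields.YangMills.Theorems.TwistedTraceScaling.Negative.R52

end
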